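import Literature.Analysis.FluidPDE.CylindricalIntegration
import Mathlib.MeasureTheory.Integral.IntegralEqImproper
import HarnessLib

/-!
# From inequalities along rays to inequalities on `ℝ³` for axisymmetric integrands
# (the passage "integrate in `z`, we obtain (2.5)" of Wei 2016, Lemma 2.3)

Analysis/FluidPDE proof file (theorems only) on the way to
`Literature.Analysis.FluidPDE.Wei2016_logModulus_regularity`
(`LeiZhang2017AxisymmetricCriteria.lean`), after

* D. Wei, *Regularity criterion to the axially symmetric Navier–Stokes equations*, J. Math. Anal.
  Appl. 435 (2016) 402–413 = arXiv:1508.03318, §2: "If `|f|²` is axially symmetric, we will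
  denote `‖f‖²_{L²} = ∫ |f|² r dr dz`, `dx = r dr dz`", and the proof of Lemma 2.3, where the
  estimates are proved ray by ray (`z` fixed) and then "integrate in `z`, we obtain (2.5)".

The ray inequalities of `Wei2016HardyLemma.lean` / `Wei2016HardyCutoff.lean` hold on every
finite interval `[0, R]`; this file supplies the generic transfer to `ℝ³`:

* `Wei2016.integral_le_of_forall_ray_le` — if `A`, `B`, `C` are integrable axisymmetric scalars
  on `ℝ³` and for every `z` and every `R ≥ R₀` the meridian profiles satisfy
  `∫₀ᴿ ρ A(ρ, 0, z) dρ ≤ M ∫₀ᴿ ρ B(ρ, 0, z) dρ + N ∫_{c₀}^R ρ C(ρ, 0, z) dρ` (`0 ≤ c₀`), then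
  `∫ A dx ≤ M ∫ B dx + N ∫_{r > c₀} C dx`.

Proof: `∫ G dx = ∫ dz c₂ ∫₀^∞ ρ G(ρ, 0, z) dρ` (`IsAxisymmetricScalar.integral_eq`,
`CylindricalIntegration.lean`; `c₂ = 2π`); for a.e. `z` the three profiles `ρ ↦ ρ G(ρ, 0, z)` are
integrable on `(0, ∞)` (Fubini in `(z, w)` and polar coordinates in the horizontal plane,
`integrable_fun_norm_addHaar`), so the improper integrals are limits of the integrals over
`(0, R)` (`intervalIntegral_tendsto_integral_Ioi`) and the ray inequality passes to the limit;
then integrate in `z`.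

## References

* D. Wei, J. Math. Anal. Appl. 435 (2016) 402–413, arXiv:1508.03318, §2 (notation `dx = r dr dz`)
  and proof of Lemma 2.3 ("integrate in `z`"). [Wei2016]
-/

noncomputable section

open MeasureTheory Set Function Filter Topology TopologicalSpace Metric
open scoped ENNReal

namespace Literature.Analysis.FluidPDE

namespace Wei2016

/-- The meridian profile `ρ ↦ ρ G(ρ, 0, z)` of an integrable scalar on `ℝ³` is integrable on
`(0, ∞)` for a.e. `z` (Fubini in the splitting `x ↦ (x₂, (x₀, x₁))` and polar coordinates in the
horizontal plane). [folklore] -/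
theorem ae_integrableOn_profile {G : EuclideanSpace ℝ (Fin 3) → ℝ} (hG : IsAxisymmetricScalar G)
    (hGi : Integrable G) :
    ∀ᵐ z : ℝ, IntegrableOn (fun ρ : ℝ => ρ * G (meridianPoint (ρ, z))) (Ioi 0) := by
  have h1 : Integrable (fun p : ℝ × EuclideanSpace ℝ (Fin 2) => G (cylSplit.symm p))
      ((volume : Measure ℝ).prod volume) := integrable_comp_cylSplit_symm_iff.2 hGi
  filter_upwards [h1.prod_right_ae] with z hz
  have h2 : Integrable (fun w : EuclideanSpace ℝ (Fin 2) => G (meridianPoint (‖w‖, z))) := by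
    refine hz.congr (Eventually.of_forall fun w => ?_)
    exact hG.apply_cylSplit_symm z w
  have h3 := (integrable_fun_norm_addHaar (E := EuclideanSpace ℝ (Fin 2)) volume
    (f := fun ρ => G (meridianPoint (ρ, z)))).1 h2
  rw [finrank_euclideanSpace, Fintype.card_fin] at h3
  simpa only [Nat.add_one_sub_one, pow_one, smul_eq_mul] using h3

/-- The `z`-integrand `z ↦ c₂ ∫₀^∞ ρ G(ρ, 0, z) dρ` of the cylindrical reduction of an integrable
axisymmetric scalar is integrable. [folklore] -/
theorem integrable_profile_integral {G : EuclideanSpace ℝ (Fin 3) → ℝ} (hG : IsAxisymmetricScalar G)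
    (hGi : Integrable G) :
    Integrable fun z : ℝ => radialConst₂ • ∫ ρ in Ioi (0 : ℝ), ρ • G (meridianPoint (ρ, z)) := by
  have h1 : Integrable (fun p : ℝ × EuclideanSpace ℝ (Fin 2) => G (cylSplit.symm p))
      ((volume : Measure ℝ).prod volume) := integrable_comp_cylSplit_symm_iff.2 hGi
  refine h1.integral_prod_left.congr (Eventually.of_forall fun z => ?_)
  exact hG.integral_slice_eq z

/-- The indicator of `{r > c₀}` times an axisymmetric scalar is an axisymmetric scalar.
[folklore] -/
theorem isAxisymmetricScalar_indicator_cylRadius {G : EuclideanSpace ℝ (Fin 3) → ℝ}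
    (hG : IsAxisymmetricScalar G) (c₀ : ℝ) :
    IsAxisymmetricScalar ({x | c₀ < cylRadius x}.indicator G) := by
  intro θ x
  by_cases h : c₀ < cylRadius x
  · have h' : c₀ < cylRadius (rotZ θ x) := by rwa [cylRadius_rotZ]
    rw [indicator_of_mem (show rotZ θ x ∈ {x | c₀ < cylRadius x} from h'),
      indicator_of_mem (show x ∈ {x | c₀ < cylRadius x} from h), hG θ x]
  · have h' : ¬ c₀ < cylRadius (rotZ θ x) := by rwa [cylRadius_rotZ]
    rw [indicator_of_notMem (show rotZ θ x ∉ {x | c₀ < cylRadius x} from h'),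
      indicator_of_notMem (show x ∉ {x | c₀ < cylRadius x} from h)]

/-- **From ray inequalities to `ℝ³`** (Wei 2016, proof of Lemma 2.3: "integrate in `z`, we
obtain (2.5)"; §2: `dx = r dr dz`). Let `A`, `B`, `C` be integrable axisymmetric scalars on
`ℝ³`, `0 ≤ c₀`, and suppose that for every `z` and every `R ≥ R₀` the meridian profiles satisfy
`∫₀ᴿ ρ A(ρ,0,z) dρ ≤ M ∫₀ᴿ ρ B(ρ,0,z) dρ + N ∫_{c₀}^R ρ C(ρ,0,z) dρ`. Then
`∫ A dx ≤ M ∫ B dx + N ∫_{r > c₀} C dx`. [cite: Wei2016, proof of Lemma 2.3 ("integrate in z, we obtain (2.5)")] -/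
theorem integral_le_of_forall_ray_le {A B C : EuclideanSpace ℝ (Fin 3) → ℝ} {M N R₀ c₀ : ℝ}
    (hA : IsAxisymmetricScalar A) (hB : IsAxisymmetricScalar B) (hC : IsAxisymmetricScalar C)
    (hAi : Integrable A) (hBi : Integrable B) (hCi : Integrable C) (hc₀ : 0 ≤ c₀)
    (hray : ∀ z : ℝ, ∀ R : ℝ, R₀ ≤ R →
      ∫ ρ in (0 : ℝ)..R, ρ * A (meridianPoint (ρ, z)) ≤
        M * (∫ ρ in (0 : ℝ)..R, ρ * B (meridianPoint (ρ, z))) +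
          N * ∫ ρ in c₀..R, ρ * C (meridianPoint (ρ, z))) :
    ∫ x, A x ≤ M * (∫ x, B x) + N * ∫ x in {x | c₀ < cylRadius x}, C x := by
  -- the truncated `C`
  set C' : EuclideanSpace ℝ (Fin 3) → ℝ := {x | c₀ < cylRadius x}.indicator C with hC'
  have hmeas : MeasurableSet {x : EuclideanSpace ℝ (Fin 3) | c₀ < cylRadius x} :=
    measurableSet_lt measurable_const continuous_cylRadius.measurable
  have hC'a : IsAxisymmetricScalar C' := isAxisymmetricScalar_indicator_cylRadius hC c₀
  have hC'i : Integrable C' := hCi.indicator hmeas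
  have hC'int : ∫ x in {x | c₀ < cylRadius x}, C x = ∫ x, C' x := (integral_indicator hmeas).symm
  -- the profile of `C'` on `(0, ∞)` is the profile of `C` restricted to `(c₀, ∞)`
  have hC'prof : ∀ z : ℝ, ∫ ρ in Ioi (0 : ℝ), ρ • C' (meridianPoint (ρ, z)) =
      ∫ ρ in Ioi c₀, ρ * C (meridianPoint (ρ, z)) := by
    intro z
    have h1 : ∀ ρ ∈ Ioi (0 : ℝ), ρ • C' (meridianPoint (ρ, z)) =
        (Ioi c₀).indicator (fun ρ => ρ * C (meridianPoint (ρ, z))) ρ := by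
      intro ρ hρ
      have hr : cylRadius (meridianPoint (ρ, z)) = ρ := by
        rw [cylRadius_meridianPoint_eq_abs, abs_of_pos hρ]
      simp only [hC', indicator, mem_setOf_eq, hr, mem_Ioi, smul_eq_mul]
      split_ifs <;> simp
    have hset : Ioi (0 : ℝ) ∩ Ioi c₀ = Ioi c₀ := by
      ext ρ
      simp only [mem_inter_iff, mem_Ioi]
      exact ⟨fun h => h.2, fun h => ⟨hc₀.trans_lt h, h⟩⟩
    rw [setIntegral_congr_fun measurableSet_Ioi h1, setIntegral_indicator measurableSet_Ioi, hset]
  -- cylindrical reduction of the three integrals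
  rw [hC'int, hA.integral_eq hAi, hB.integral_eq hBi, hC'a.integral_eq hC'i,
    ← integral_const_mul, ← integral_const_mul]
  rw [← integral_add ((integrable_profile_integral hB hBi).const_mul M)
    ((integrable_profile_integral hC'a hC'i).const_mul N)]
  refine integral_mono_ae (integrable_profile_integral hA hAi)
    (((integrable_profile_integral hB hBi).const_mul M).add
      ((integrable_profile_integral hC'a hC'i).const_mul N)) ?_
  -- the ray inequality passes to the limit `R → ∞` for a.e. `z`
  filter_upwards [ae_integrableOn_profile hA hAi, ae_integrableOn_profile hB hBi,
    ae_integrableOn_profile hC hCi] with z hzA hzB hzC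
  have hc₂ := radialConst₂_pos
  rw [hC'prof z]
  simp only [smul_eq_mul]
  have hzC' : IntegrableOn (fun ρ : ℝ => ρ * C (meridianPoint (ρ, z))) (Ioi c₀) :=
    hzC.mono_set (Ioi_subset_Ioi hc₀)
  have hlimA := intervalIntegral_tendsto_integral_Ioi 0 hzA tendsto_id
  have hlimB := intervalIntegral_tendsto_integral_Ioi 0 hzB tendsto_id
  have hlimC := intervalIntegral_tendsto_integral_Ioi c₀ hzC' tendsto_id
  have hle : ∫ ρ in Ioi (0 : ℝ), ρ * A (meridianPoint (ρ, z)) ≤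
      M * (∫ ρ in Ioi (0 : ℝ), ρ * B (meridianPoint (ρ, z))) +
        N * ∫ ρ in Ioi c₀, ρ * C (meridianPoint (ρ, z)) := by
    refine le_of_tendsto_of_tendsto hlimA ((hlimB.const_mul M).add (hlimC.const_mul N)) ?_
    filter_upwards [eventually_ge_atTop R₀] with R hR
    exact hray z R hR
  have := mul_le_mul_of_nonneg_left hle hc₂.le
  simpa only [mul_add, smul_eq_mul, mul_left_comm radialConst₂ M, mul_left_comm radialConst₂ N]
    using this

end Wei2016

end Literature.Analysis.FluidPDE

end
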